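import Summits.CriticalPhenomena.PercolationContinuityZ3.Theorems.PercNearOneGluingNoHeavyLowerTailKnQuestion8CoefficientwiseCoreClassKernelMixHubToggle
import HarnessLib

/-!
# The `(j,u)` involution on wall sets (PATH LEMMA of hub-Kleitman, memo §1.5: the map `g` on the family 𝔼)

Support file (`--supports stmt-CriticalPhenomena-4575`, closed), prover `prim-cplus-coupling` (gen 51).  No definitions, no notations,
no named facts, no sorries; standard axioms.  Memo `prim-cplus-coupling/A5-COUPLING-gen51.md` §1.5.

For the gate type `(j,u)` with blue threshold `t ≥ 1` the sources and the targets of the path lemma are both indexed by the wall family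
`𝔼 = {D : min D ≥ t (D ≠ ∅), |D| odd ⇒ max D ≥ q}` (memo §1.5, `q = q₂`), and the matching is `D ↦ g(D)` with
`g(D) = D △ {t, q-1}` if `|D|` even, `D ⊆ [t, q-1]`, `t < q-1`;  `g(∅) = ∅` if `t = q-1` or `t = ℓ`;  `g(D) = D △ {t}` otherwise
(hypothesis `hg`).  This file proves the two facts the word-level transport (`…KernelMixHubPathJU`) needs:
* `hubPath_ju_image` — elements of `g(D)` are `≥ t`, and if `|g(D)|` is odd then `g(D)` has an element `≥ q`;
* `hubPath_ju_inj` — `g` is injective on `𝔼` (memo: `g` is an involution of `𝔼`; injectivity is what is used).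
[cite: KozmaNitzan2024, Questions 8–9 (§5.5 p. 36) (context)]
-/

namespace Summit.CriticalPhenomena.PercolationContinuityZ3.Theorems

open Finset
open scoped symmDiff

namespace Coefficientwise

/-- Membership in `D △ {a}`. [folklore] -/
theorem hubPath_mem_symmDiff_singleton (D : Finset ℕ) (a e : ℕ) : e ∈ D ∆ {a} ↔ ((e ∈ D ∧ e ≠ a) ∨ (e = a ∧ e ∉ D)) := by
  rw [Finset.mem_symmDiff, Finset.mem_singleton]

/-- **Image facts for `g`.**  On `𝔼`, `g(D)` has all elements `≥ t`, and an element `≥ q` whenever `|g(D)|` is odd. [folklore] -/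
theorem hubPath_ju_image (ℓ t q : ℕ) (ht : 1 ≤ t) (g : Finset ℕ → Finset ℕ)
    (hg : ∀ D, g D = if (Even D.card ∧ (∀ d ∈ D, d < q) ∧ t + 2 ≤ q) then D ∆ {t} ∆ {q - 1}
      else if (D = ∅ ∧ (t + 1 = q ∨ t = ℓ)) then ∅ else D ∆ {t})
    (D : Finset ℕ) (hDt : ∀ d ∈ D, t ≤ d) (hDq : ¬ Even D.card → ∃ d ∈ D, q ≤ d) :
    (∀ e ∈ g D, t ≤ e) ∧ (¬ Even (g D).card → ∃ e ∈ g D, q ≤ e) := by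
  rw [hg]
  split_ifs with hβ hγ
  · -- case β
    refine ⟨fun e he => ?_, fun hodd => ?_⟩
    · rw [hubPath_mem_symmDiff_singleton] at he
      rcases he with ⟨he, _⟩ | ⟨rfl, _⟩
      · rw [hubPath_mem_symmDiff_singleton] at he
        rcases he with ⟨he, _⟩ | ⟨rfl, _⟩
        · exact hDt e he
        · exact le_refl _
      · omega
    · exfalso
      rw [card_symmDiff_singleton_even_iff, card_symmDiff_singleton_even_iff, not_not] at hodd
      exact hodd hβ.1
  · -- case γ
    exact ⟨fun e he => by simp at he, fun hodd => by simp at hodd⟩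
  · -- case α
    refine ⟨fun e he => ?_, fun hodd => ?_⟩
    · rw [hubPath_mem_symmDiff_singleton] at he
      rcases he with ⟨he, _⟩ | ⟨rfl, _⟩
      · exact hDt e he
      · exact le_refl _
    · rw [card_symmDiff_singleton_even_iff, not_not] at hodd
      -- D even: D = ∅ forces q ≤ t (not β, not γ); D ≠ ∅ forces an element ≥ q other than t
      by_cases hD0 : D = ∅
      · subst hD0
        have hq : q ≤ t := by
          by_contra h
          push Not at h
          have h1 : ¬ (t + 2 ≤ q) := fun h2 => hβ ⟨hodd, fun d hd => by simp at hd, h2⟩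
          exact hγ ⟨rfl, Or.inl (by omega)⟩
        refine ⟨t, ?_, hq⟩
        rw [hubPath_mem_symmDiff_singleton]; exact Or.inr ⟨rfl, by simp⟩
      · have hne : D.Nonempty := Finset.nonempty_iff_ne_empty.mpr hD0
        -- D even nonempty: it has two elements, so max D > min D ≥ t
        have hcard : 2 ≤ D.card := by
          obtain ⟨k, hk⟩ := hodd
          have := Finset.card_pos.mpr hne
          omega
        have hM := D.max'_mem hne
        have hm := D.min'_mem hne
        have hlt : D.min' hne < D.max' hne := by
          by_contra h
          push Not at h
          have heq : D.min' hne = D.max' hne := le_antisymm (D.min'_le _ hM) h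
          have : D.card ≤ 1 := by
            rw [Finset.card_le_one]
            intro a ha b hb
            have h1 := D.min'_le a ha; have h2 := D.le_max' a ha
            have h3 := D.min'_le b hb; have h4 := D.le_max' b hb
            omega
          omega
        have hMq : q ≤ D.max' hne := by
          by_contra h
          push Not at h
          apply hβ
          refine ⟨hodd, fun d hd => lt_of_le_of_lt (D.le_max' d hd) h, ?_⟩
          have := hDt _ hm
          omega
        refine ⟨D.max' hne, ?_, hMq⟩
        rw [hubPath_mem_symmDiff_singleton]
        refine Or.inl ⟨hM, fun h => ?_⟩
        have := hDt _ hm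
        omega

/-- **`g` is injective on `𝔼`.** [folklore] -/
theorem hubPath_ju_inj (ℓ t q : ℕ) (ht : 1 ≤ t) (hq : q ≤ ℓ) (g : Finset ℕ → Finset ℕ)
    (hg : ∀ D, g D = if (Even D.card ∧ (∀ d ∈ D, d < q) ∧ t + 2 ≤ q) then D ∆ {t} ∆ {q - 1}
      else if (D = ∅ ∧ (t + 1 = q ∨ t = ℓ)) then ∅ else D ∆ {t})
    (D₁ D₂ : Finset ℕ)
    (h₁t : ∀ d ∈ D₁, t ≤ d) (h₁q : ¬ Even D₁.card → ∃ d ∈ D₁, q ≤ d) (h₁ℓ : ∀ d ∈ D₁, d ≤ ℓ - 1)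
    (h₂t : ∀ d ∈ D₂, t ≤ d) (h₂q : ¬ Even D₂.card → ∃ d ∈ D₂, q ≤ d) (h₂ℓ : ∀ d ∈ D₂, d ≤ ℓ - 1)
    (h : g D₁ = g D₂) : D₁ = D₂ := by
  -- invariants of the image in each case
  have key : ∀ D : Finset ℕ, (∀ d ∈ D, t ≤ d) → (¬ Even D.card → ∃ d ∈ D, q ≤ d) → (∀ d ∈ D, d ≤ ℓ - 1) →
      ((Even D.card ∧ (∀ d ∈ D, d < q) ∧ t + 2 ≤ q) ∧ g D = D ∆ {t} ∆ {q - 1} ∧ Even (g D).card ∧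
          (∀ e ∈ g D, e < q)) ∨
      ((D = ∅ ∧ (t + 1 = q ∨ t = ℓ)) ∧ g D = ∅) ∨
      (¬ (Even D.card ∧ (∀ d ∈ D, d < q) ∧ t + 2 ≤ q) ∧ ¬ (D = ∅ ∧ (t + 1 = q ∨ t = ℓ)) ∧ g D = D ∆ {t} ∧
          (Even (g D).card → g D = ∅ ∨ ∃ e ∈ g D, q ≤ e) ∧ (g D = ∅ → D = {t} ∧ q ≤ t ∧ t ≤ ℓ - 1)) := by
    intro D hDt hDq hDℓ
    by_cases hβ : Even D.card ∧ (∀ d ∈ D, d < q) ∧ t + 2 ≤ q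
    · refine Or.inl ⟨hβ, by rw [hg, if_pos hβ], ?_, ?_⟩
      · rw [hg, if_pos hβ, card_symmDiff_singleton_even_iff, card_symmDiff_singleton_even_iff, not_not]; exact hβ.1
      · intro e he
        rw [hg, if_pos hβ, hubPath_mem_symmDiff_singleton] at he
        rcases he with ⟨he, _⟩ | ⟨rfl, _⟩
        · rw [hubPath_mem_symmDiff_singleton] at he
          rcases he with ⟨he, _⟩ | ⟨rfl, _⟩
          · exact hβ.2.1 e he
          · omega
        · omega
    by_cases hγ : D = ∅ ∧ (t + 1 = q ∨ t = ℓ)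
    · exact Or.inr (Or.inl ⟨hγ, by rw [hg, if_neg hβ, if_pos hγ]⟩)
    · have hgD : g D = D ∆ {t} := by rw [hg, if_neg hβ, if_neg hγ]
      refine Or.inr (Or.inr ⟨hβ, hγ, hgD, fun hev => ?_, fun h0 => ?_⟩)
      · -- g D even ⇒ D odd ⇒ max D ≥ q survives unless D = {t}
        rw [hgD, card_symmDiff_singleton_even_iff] at hev
        obtain ⟨d, hd, hdq⟩ := hDq hev
        by_cases hdt : d = t
        · -- then every element ≥ q… we only need: either g D = ∅ or some element ≥ q remains
          by_cases hex : ∃ e ∈ D, e ≠ t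
          · obtain ⟨e, he, het⟩ := hex
            by_cases heq : q ≤ e
            · exact Or.inr ⟨e, by rw [hgD, hubPath_mem_symmDiff_singleton]; exact Or.inl ⟨he, het⟩, heq⟩
            · -- e < q ≤ d = t ≤ e : impossible
              have := hDt e he; omega
          · push Not at hex
            left
            rw [hgD, Finset.eq_empty_iff_forall_notMem]
            intro e he
            rw [hubPath_mem_symmDiff_singleton] at he
            rcases he with ⟨he, hne⟩ | ⟨rfl, hne⟩
            · exact hne (hex e he)
            · exact hne (hdt ▸ hd)
        · exact Or.inr ⟨d, by rw [hgD, hubPath_mem_symmDiff_singleton]; exact Or.inl ⟨hd, hdt⟩, hdq⟩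
      · -- g D = ∅ ⇒ D = {t}
        rw [hgD] at h0
        have hDt' : D = {t} := by
          ext e
          rw [Finset.mem_singleton]
          constructor
          · intro he
            by_contra hne
            have : e ∈ D ∆ {t} := by rw [hubPath_mem_symmDiff_singleton]; exact Or.inl ⟨he, hne⟩
            rw [h0] at this; simp at this
          · rintro rfl
            by_contra hne
            have : e ∈ D ∆ {e} := by rw [hubPath_mem_symmDiff_singleton]; exact Or.inr ⟨rfl, hne⟩
            rw [h0] at this; simp at this
        have hodd : ¬ Even D.card := by rw [hDt']; simp
        obtain ⟨d, hd, hdq⟩ := hDq hodd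
        rw [hDt', Finset.mem_singleton] at hd
        refine ⟨hDt', by omega, ?_⟩
        have := hDℓ t (by rw [hDt']; exact Finset.mem_singleton_self _)
        exact this
  have sd2 : ∀ A B : Finset ℕ, ∀ a b : ℕ, A ∆ {a} ∆ {b} = B ∆ {a} ∆ {b} → A = B := by
    intro A B a b hAB
    have := congrArg (fun Z => Z ∆ {b} ∆ {a}) hAB
    simpa [symmDiff_assoc, symmDiff_self] using this
  have sd1 : ∀ A B : Finset ℕ, ∀ a : ℕ, A ∆ {a} = B ∆ {a} → A = B := by
    intro A B a hAB
    have := congrArg (fun Z => Z ∆ {a}) hAB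
    simpa [symmDiff_assoc, symmDiff_self] using this
  rcases key D₁ h₁t h₁q h₁ℓ with ⟨hβ₁, hg₁, hev₁, hlt₁⟩ | ⟨hγ₁, hg₁⟩ | ⟨hnβ₁, hnγ₁, hg₁, hev₁, hz₁⟩ <;>
    rcases key D₂ h₂t h₂q h₂ℓ with ⟨hβ₂, hg₂, hev₂, hlt₂⟩ | ⟨hγ₂, hg₂⟩ | ⟨hnβ₂, hnγ₂, hg₂, hev₂, hz₂⟩
  · exact sd2 _ _ _ _ (by rw [← hg₁, ← hg₂, h])
  · -- β vs γ : g D₁ = ∅ ⇒ D₁ = {t, q-1}, contradiction with the arithmetic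
    exfalso
    have h0 : D₁ ∆ {t} ∆ {q - 1} = ∅ := by rw [← hg₁, h, hg₂]
    have htm : t ∈ D₁ := by
      by_contra hnt
      have : t ∈ D₁ ∆ {t} ∆ {q - 1} := by
        rw [hubPath_mem_symmDiff_singleton]; refine Or.inl ⟨?_, by omega⟩
        rw [hubPath_mem_symmDiff_singleton]; exact Or.inr ⟨rfl, hnt⟩
      rw [h0] at this; simp at this
    rcases hγ₂.2 with h2 | h2
    · omega
    · have := h₁ℓ t htm; omega
  · -- β vs α
    exfalso
    rw [h] at hev₁ hlt₁
    rcases hev₂ hev₁ with h0 | ⟨e, he, heq⟩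
    · obtain ⟨_, hqt, _⟩ := hz₂ h0
      omega
    · have := hlt₁ e he; omega
  · exfalso
    have h0 : D₂ ∆ {t} ∆ {q - 1} = ∅ := by rw [← hg₂, ← h, hg₁]
    have htm : t ∈ D₂ := by
      by_contra hnt
      have : t ∈ D₂ ∆ {t} ∆ {q - 1} := by
        rw [hubPath_mem_symmDiff_singleton]; refine Or.inl ⟨?_, by omega⟩
        rw [hubPath_mem_symmDiff_singleton]; exact Or.inr ⟨rfl, hnt⟩
      rw [h0] at this; simp at this
    rcases hγ₁.2 with h1 | h1
    · omega
    · have := h₂ℓ t htm; omega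
  · rw [hγ₁.1, hγ₂.1]
  · -- γ vs α : g D₂ = ∅ ⇒ D₂ = {t}, q ≤ t ≤ ℓ - 1; γ says t + 1 = q or t = ℓ
    exfalso
    obtain ⟨_, hqt, htl⟩ := hz₂ (by rw [← h, hg₁])
    rcases hγ₁.2 with h1 | h1 <;> omega
  · exfalso
    rw [← h] at hev₂ hlt₂
    rcases hev₁ hev₂ with h0 | ⟨e, he, heq⟩
    · obtain ⟨_, hqt, _⟩ := hz₁ h0
      omega
    · have := hlt₂ e he; omega
  · exfalso
    obtain ⟨_, hqt, htl⟩ := hz₁ (by rw [h, hg₂])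
    rcases hγ₂.2 with h2 | h2 <;> omega
  · exact sd1 _ _ _ (by rw [← hg₁, ← hg₂, h])

end Coefficientwise

end Summit.CriticalPhenomena.PercolationContinuityZ3.Theorems
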